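import Literature.NumberTheory.Automorphic.FuchsianMaassSelberg

/-!
# The Maass–Selberg relations on `Re s > 1` by analytic continuation; symmetry of the scattering matrix
(Iwaniec, *Spectral Methods of Automorphic Forms*, GSM 53, §6.4 Prop. 6.8 (6.30), PDF p. 88;
§6.3 Theorem 6.6, (6.25) `Φ(s) = ᵗΦ(s)`, PDF p. 87)

Fifteenth brick of the general-`Γ` Eisenstein series (after `FuchsianMaassSelberg`). For a discrete
`Γ ≤ SL₂(ℝ)` with `-1 ∈ Γ`, a measurable fundamental domain `F` of finite area, a complete system of
inequivalent cusps `𝔞ᵢ = σᵢ∞` with width-one scaling matrices and `Y ≥ 1` — PROVED, nothing vendored,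
no fact introduced:

1. (§1) the constant term `y ↦ f_𝔞(y)` of a bounded measurable automorphic `f` is a.e. strongly
   measurable on `(0, ∞)` (`aestronglyMeasurable_cuspMeanAt`; limit of the Fubini-integrable unfolded
   integrands of the weights `y²𝟙_{(1/n,n)}`).
2. (§2) **the Maass–Selberg pairing unfolded and as a Mellin transform**: for `Re s₁, Re s₂ > 1`,
   `∫_F E^Y_𝔞ᵢ(·,s₁) E^Y_𝔞ⱼ(·,s₂) dμ = ∫₀^Y y^{s₁-2} (E^Y_𝔞ⱼ(·,s₂))_𝔞ᵢ(y) dy = ℳ[(E^Y_𝔞ⱼ(·,s₂))_𝔞ᵢ 𝟙_{≤Y}](s₁ - 1)`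
   (`setIntegral_eisTrunc_mul_eq(_mellin)`: in the decomposition `eisTrunc_eq_decomp` of the first
   factor the high pieces pair to ZERO with `E^Y_𝔞ⱼ(·,s₂)`, whose constant terms vanish above `Y`),
   hence **holomorphic in `s₁` on `Re s₁ > 1`** (`differentiableOn_setIntegral_eisTrunc_mul`, Mathlib's
   `mellin_differentiableAt_of_isBigO_rpow` for a bounded function supported in `(0, Y]`).
3. (§3) **Prop. 6.8 on the whole region `Re s₁, Re s₂ > 1`, `s₁ ≠ s₂`** (`maassSelberg_of_ne`): the
   identity theorem on the half-plane `Re s₁ > 1` applied to `(s₁ - s₂) ×` both sides of (6.30),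
   which agree on `Re s₁ > Re s₂ + 1` by `maassSelberg`; and, evaluating the cleared identity AT
   `s₁ = s₂ = s`, **the symmetry of the scattering matrix `φ_𝔞ᵢ𝔞ⱼ(s) = φ_𝔞ⱼ𝔞ᵢ(s)` for `Re s > 1`**
   (`eisScattering_symm`, Iwaniec (6.25) — in the book read off the Dirichlet series (3.21); here the
   residue `φⱼᵢ(s) - φᵢⱼ(s)` of the right-hand side of (6.30) at `s₁ = s₂` must vanish because the
   left-hand side is holomorphic there).

## References
* [Iwaniec2002] H. Iwaniec, *Spectral Methods of Automorphic Forms*, 2nd ed., GSM 53, AMS 2002,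
  Prop. 6.8 (6.30), PDF p. 88; Thm 6.6 & (6.25), PDF p. 87
  (held copy `book:iwaniec2002-spectral-methods-automorphic-forms`).

Mathlib: `mellin`, `mellin_differentiableAt_of_isBigO_rpow`, `AnalyticOnNhd.eqOn_of_preconnected_of_eventuallyEq`,
`DifferentiableOn.analyticOnNhd`, `convex_halfSpace_re_gt`, `Convex.isPreconnected`,
`aestronglyMeasurable_of_tendsto_ae`, `IntegrableOn.of_bound`, `DifferentiableAt.const_cpow`. Literature:
`maassSelberg`, `integrableOn_mul_of_bounded` (`FuchsianMaassSelberg`); `setIntegral_incEisCusp_mul_of_heightBound`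
(`FuchsianMaassSelbergLowLow`); `eisTrunc_eq_decomp`, `cutLow`, `cutHigh`, `exists_norm_incEisCusp_cutLow_le`,
`norm_incEisCusp_cutHigh_le`, `integrableOn_norm_cutHigh` (`FuchsianEisensteinTruncationPairings`);
`setIntegral_incEisCusp_mul_of_bounded`, `integrableOn_lowProfile` (`FuchsianUnfoldingBounded`); `eisTrunc`,
`cuspMeanAt_eisTrunc_eq_zero`, `exists_norm_eisTrunc_le`, `measurable_eisTrunc`, `isAutomorphic_eisTrunc`
(`FuchsianEisensteinTruncation`); `differentiableOn_eisScattering` (`FuchsianEisensteinHolomorphy`);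
`eisScattering` (`FuchsianEisensteinConstantTerm`); `cuspMeanAt_apply` (`FuchsianCuspidalSubspace`).
-/

noncomputable section

namespace Literature.NumberTheory.Automorphic

open Matrix UpperHalfPlane
open scoped MatrixGroups

namespace Fuchsian

variable {Γ : Subgroup (GL (Fin 2) ℝ)} {h : ℕ} {𝔞 : Fin h → OnePoint ℝ} {σ : Fin h → SL(2, ℝ)}

/-! ## 1. Measurability of constant terms in the height -/

section Measurability

open _root_.MeasureTheory _root_.Set _root_.Filter
open scoped _root_.Pointwise _root_.ENNReal _root_.Topology

/-- **The constant term `y ↦ f_𝔞(y)` of a bounded measurable automorphic function is a.e. strongly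
measurable on `(0, ∞)`** (from the Fubini integrability of the unfolded integrands of the truncated
weights `y²𝟙_{(1/n, n)}`, letting `n → ∞`). [folklore] -/
theorem aestronglyMeasurable_cuspMeanAt {F : Set ℍ}
    (hΓ : Γ ≤ (Matrix.SpecialLinearGroup.toGL : SL(2, ℝ) →* GL (Fin 2) ℝ).range)
    (hneg : (-1 : GL (Fin 2) ℝ) ∈ Γ) (hd : IsDiscreteSubgroup Γ)
    (hF : IsHypFundamentalDomain Γ F) (s' : SL(2, ℝ))
    (hper : (ConjAct.toConjAct (Matrix.SpecialLinearGroup.toGL s' : GL (Fin 2) ℝ)⁻¹ • Γ).strictPeriods =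
      AddSubgroup.zmultiples 1)
    {f : ℍ → ℂ} (hfa : IsAutomorphic Γ f) (hfm : Measurable f) {B : ℝ} (hfb : ∀ z, ‖f z‖ ≤ B) :
    AEStronglyMeasurable (fun y : ℝ => cuspMeanAt s' f (UpperHalfPlane.ofComplex ⟨0, y⟩))
      (volume.restrict (Ioi 0)) := by
  have hB0 : 0 ≤ B := (norm_nonneg _).trans (hfb UpperHalfPlane.I)
  set ψ : ℕ → ℝ → ℂ := fun n y =>
    if y ∈ Ioo (1 / ((n : ℝ) + 1)) ((n : ℝ) + 1) then (((y ^ 2 : ℝ)) : ℂ) else 0 with hψ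
  have hψm : ∀ n, Measurable (ψ n) := fun n =>
    Measurable.ite measurableSet_Ioo (Complex.measurable_ofReal.comp (measurable_id.pow_const 2)) measurable_const
  have hint : ∀ n, IntegrableOn (fun y : ℝ => ‖ψ n y‖ * (fun _ : ℝ => B) y * (y ^ 2)⁻¹) (Ioi 0) := by
    intro n
    have h1 : IntegrableOn (fun _ : ℝ => B) (Ioo (1 / ((n : ℝ) + 1)) ((n : ℝ) + 1)) :=
      integrableOn_const (by rw [Real.volume_Ioo]; exact ENNReal.ofReal_ne_top)
    have hE : IntegrableOn (fun y : ℝ => ‖ψ n y‖ * (fun _ : ℝ => B) y * (y ^ 2)⁻¹)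
        (Ioi 0 ∩ Ioo (1 / ((n : ℝ) + 1)) ((n : ℝ) + 1)) := by
      refine (h1.mono_set inter_subset_right).congr_fun (fun y hy => ?_) (measurableSet_Ioi.inter measurableSet_Ioo)
      have hy0 : 0 < y := hy.1
      show B = ‖ψ n y‖ * B * (y ^ 2)⁻¹
      simp only [hψ, if_pos hy.2]
      rw [Complex.norm_real, Real.norm_of_nonneg (by positivity)]
      field_simp
    have hZ : IntegrableOn (fun y : ℝ => ‖ψ n y‖ * (fun _ : ℝ => B) y * (y ^ 2)⁻¹)
        (Ioi 0 \ Ioo (1 / ((n : ℝ) + 1)) ((n : ℝ) + 1)) := by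
      refine integrableOn_zero.congr_fun (fun y hy => ?_) (measurableSet_Ioi.diff measurableSet_Ioo)
      have : y ∉ Ioo (1 / ((n : ℝ) + 1)) ((n : ℝ) + 1) := hy.2
      simp only [hψ, if_neg this]; simp
    have := hE.union hZ
    rwa [inter_union_sdiff] at this
  have hg : ∀ n, AEStronglyMeasurable (fun y : ℝ => (ψ n y * (((y ^ 2)⁻¹ : ℝ) : ℂ)) *
      cuspMeanAt s' f (UpperHalfPlane.ofComplex ⟨0, y⟩)) (volume.restrict (Ioi 0)) := fun n =>
    ((setIntegral_incEisCusp_mul_of_heightBound hΓ hneg hd hF s' hper (hψm n) hfa hfm (M := fun _ => B)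
      (fun x y _ => hfb _) (hint n)).1).aestronglyMeasurable
  refine aestronglyMeasurable_of_tendsto_ae atTop hg ?_
  filter_upwards [ae_restrict_mem measurableSet_Ioi] with y hy
  have hy0 : 0 < y := hy
  -- eventually `y ∈ (1/(n+1), n+1)`, where the sequence is constant
  have hev : ∀ᶠ n : ℕ in atTop, (ψ n y * (((y ^ 2)⁻¹ : ℝ) : ℂ)) * cuspMeanAt s' f (UpperHalfPlane.ofComplex ⟨0, y⟩) =
      cuspMeanAt s' f (UpperHalfPlane.ofComplex ⟨0, y⟩) := by
    have h1 : ∀ᶠ n : ℕ in atTop, y < (n : ℝ) + 1 := by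
      obtain ⟨N, hN⟩ := exists_nat_gt y
      filter_upwards [eventually_ge_atTop N] with n hn
      have : (N : ℝ) ≤ n := by exact_mod_cast hn
      linarith
    have h2 : ∀ᶠ n : ℕ in atTop, 1 / ((n : ℝ) + 1) < y := by
      obtain ⟨N, hN⟩ := exists_nat_gt (1 / y)
      filter_upwards [eventually_ge_atTop N] with n hn
      have hn' : (N : ℝ) ≤ n := by exact_mod_cast hn
      rw [div_lt_iff₀ (by positivity)]
      rw [div_lt_iff₀ hy0] at hN
      nlinarith
    filter_upwards [h1, h2] with n hn1 hn2
    have hmem : y ∈ Ioo (1 / ((n : ℝ) + 1)) ((n : ℝ) + 1) := ⟨hn2, hn1⟩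
    simp only [hψ, if_pos hmem]
    have : (((y ^ 2 : ℝ)) : ℂ) * (((y ^ 2)⁻¹ : ℝ) : ℂ) = 1 := by
      rw [← Complex.ofReal_mul, mul_inv_cancel₀ (by positivity)]; simp
    rw [this, one_mul]
  exact tendsto_const_nhds.congr' (EventuallyEq.symm hev)

end Measurability

/-! ## 2. The Maass–Selberg pairing as a Mellin transform; holomorphy in `s₁` -/

section Mellin

open _root_.MeasureTheory _root_.Set _root_.Filter _root_.Asymptotics
open scoped _root_.Pointwise _root_.ENNReal _root_.Topology

variable {F : Set ℍ}
variable (hΓ : Γ ≤ (Matrix.SpecialLinearGroup.toGL : SL(2, ℝ) →* GL (Fin 2) ℝ).range)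
  (hneg : (-1 : GL (Fin 2) ℝ) ∈ Γ) (hd : IsDiscreteSubgroup Γ) (hF : IsHypFundamentalDomain Γ F)
  (hvol : volume F < ⊤)
  (hinfty : ∀ i, (Matrix.SpecialLinearGroup.toGL (σ i) : GL (Fin 2) ℝ) • (OnePoint.infty : OnePoint ℝ) = 𝔞 i)
  (hper : ∀ i, (ConjAct.toConjAct (Matrix.SpecialLinearGroup.toGL (σ i) : GL (Fin 2) ℝ)⁻¹ • Γ).strictPeriods =
    AddSubgroup.zmultiples 1)
  (hineq : ∀ i j, ∀ γ ∈ Γ, γ • 𝔞 i = 𝔞 j → i = j)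
  (hcomplete : ∀ c : OnePoint ℝ, IsCusp c Γ → ∃ i, ∃ γ ∈ Γ, γ • 𝔞 i = c)

include hΓ hneg hd hF hvol hinfty hper hineq hcomplete in
/-- **The pairing of two truncated Eisenstein series, unfolded**: for `Re s₁, Re s₂ > 1`, `Y ≥ 1`,
`∫_F E^Y_𝔞ᵢ(·, s₁) E^Y_𝔞ⱼ(·, s₂) dμ = ∫₀^Y y^{s₁ - 2} (E^Y_𝔞ⱼ(·, s₂))_𝔞ᵢ(y) dy`:
in `E^Y_𝔞ᵢ(s₁) = E_𝔞ᵢ(·|y^{s₁}𝟙_{≤Y}) - Σₖ φᵢₖ(s₁) E_𝔞ₖ(·|y^{1-s₁}𝟙_{>Y})` the high pieces pair to ZERO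
with `E^Y_𝔞ⱼ(s₂)` (unfolding: its constant terms vanish above `Y`), and the low piece unfolds.
[cite: Iwaniec2002, Lemma 3.3 & (6.20), (6.29), PDF pp. 44, 87–88] -/
theorem setIntegral_eisTrunc_mul_eq (i j : Fin h) {s₁ s₂ : ℂ} (hs₁ : 1 < s₁.re) (hs₂ : 1 < s₂.re) {Y : ℝ}
    (hY : 1 ≤ Y) :
    ∫ z in F, eisTrunc Γ σ i s₁ Y z * eisTrunc Γ σ j s₂ Y z =
      ∫ y in Ioi (0 : ℝ), (cutLow s₁ Y y * (((y ^ 2)⁻¹ : ℝ) : ℂ)) *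
        cuspMeanAt (σ i) (eisTrunc Γ σ j s₂ Y) (UpperHalfPlane.ofComplex ⟨0, y⟩) := by
  have hY0 : 0 < Y := by linarith
  set E₂ : ℍ → ℂ := eisTrunc Γ σ j s₂ Y with hE₂
  obtain ⟨B₂, hB₂⟩ := exists_norm_eisTrunc_le hΓ hneg hd hF hvol hinfty hper hineq hcomplete hs₂ j hY
  have hE₂m : Measurable E₂ := measurable_eisTrunc hΓ hd hper hs₂ j hY0
  have hE₂a : IsAutomorphic Γ E₂ := isAutomorphic_eisTrunc hΓ j s₂ Y
  obtain ⟨B₁, hB₁⟩ := exists_norm_incEisCusp_cutLow_le hΓ hneg hd hinfty hper hineq hF hvol hcomplete i hs₁ hY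
  have hw₁ : (1 - s₁).re ≤ 0 := by simp; linarith
  -- decomposition of the first factor
  have hpt : ∀ z, eisTrunc Γ σ i s₁ Y z * E₂ z =
      incEisCusp Γ (σ i) (cutLow s₁ Y) z * E₂ z -
        ∑ k, eisScattering Γ σ i k s₁ * (incEisCusp Γ (σ k) (cutHigh (1 - s₁) Y) z * E₂ z) := by
    intro z
    rw [eisTrunc_eq_decomp hΓ hd hper i hs₁ hY0 z, sub_mul, Finset.sum_mul]
    congr 1
    exact Finset.sum_congr rfl fun k _ => by ring
  have hI1 : IntegrableOn (fun z => incEisCusp Γ (σ i) (cutLow s₁ Y) z * E₂ z) F :=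
    integrableOn_mul_of_bounded hvol (measurable_incEisCusp_cutLow hΓ hd hper i hs₁ hY0) hE₂m hB₁ hB₂
  have hI2 : ∀ k, IntegrableOn (fun z => incEisCusp Γ (σ k) (cutHigh (1 - s₁) Y) z * E₂ z) F := fun k =>
    integrableOn_mul_of_bounded hvol (measurable_incEisCusp_cutHigh hΓ hd hper k _ hY0) hE₂m
      (norm_incEisCusp_cutHigh_le hΓ hd hper k hw₁ hY0) hB₂
  have hIs : IntegrableOn (fun z => ∑ k, eisScattering Γ σ i k s₁ *
      (incEisCusp Γ (σ k) (cutHigh (1 - s₁) Y) z * E₂ z)) F :=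
    integrable_finsetSum _ fun k _ => (hI2 k).const_mul _
  -- the high pieces pair to zero
  have hzero : ∀ k, ∫ z in F, incEisCusp Γ (σ k) (cutHigh (1 - s₁) Y) z * E₂ z = 0 := by
    intro k
    rw [setIntegral_incEisCusp_mul_of_bounded hΓ hneg hd hF (σ k) (hper k) (measurable_cutHigh _ Y)
      (integrableOn_norm_cutHigh (by simp; linarith) hY0) hE₂a hE₂m hB₂]
    have e : ∀ y ∈ Ioi (0 : ℝ), (cutHigh (1 - s₁) Y y * (((y ^ 2)⁻¹ : ℝ) : ℂ)) *
        cuspMeanAt (σ k) E₂ (UpperHalfPlane.ofComplex ⟨0, y⟩) = 0 := by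
      intro y _
      by_cases hyY : Y < y
      · rw [hE₂, cuspMeanAt_eisTrunc_eq_zero hΓ hneg hd hinfty hper hineq hs₂ j k hY hyY, mul_zero]
      · rw [cutHigh_of_le (not_lt.mp hyY)]; simp
    rw [setIntegral_congr_fun measurableSet_Ioi e, integral_zero]
  simp_rw [hpt]
  rw [integral_sub hI1 hIs, integral_finsetSum _ (fun k _ => (hI2 k).const_mul _)]
  simp_rw [integral_const_mul, hzero, mul_zero, Finset.sum_const_zero, sub_zero]
  exact setIntegral_incEisCusp_mul_of_bounded hΓ hneg hd hF (σ i) (hper i) (measurable_cutLow s₁ Y)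
    (integrableOn_lowProfile hs₁ hY0) hE₂a hE₂m hB₂

include hΓ hneg hd hF hvol hinfty hper hineq hcomplete in
/-- **Hence the pairing is a Mellin transform**: with `C(y) = (E^Y_𝔞ⱼ(·, s₂))_𝔞ᵢ(y) 𝟙_{y ≤ Y}` (bounded,
supported in `(0, Y]`), `∫_F E^Y_𝔞ᵢ(·, s₁) E^Y_𝔞ⱼ(·, s₂) dμ = (ℳC)(s₁ - 1)` for `Re s₁ > 1`.
[cite: Iwaniec2002, (6.29)–(6.30), PDF p. 88] -/
theorem setIntegral_eisTrunc_mul_eq_mellin (i j : Fin h) {s₁ s₂ : ℂ} (hs₁ : 1 < s₁.re) (hs₂ : 1 < s₂.re)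
    {Y : ℝ} (hY : 1 ≤ Y) :
    ∫ z in F, eisTrunc Γ σ i s₁ Y z * eisTrunc Γ σ j s₂ Y z =
      mellin (fun y : ℝ => if y ≤ Y then cuspMeanAt (σ i) (eisTrunc Γ σ j s₂ Y) (UpperHalfPlane.ofComplex ⟨0, y⟩)
        else 0) (s₁ - 1) := by
  rw [setIntegral_eisTrunc_mul_eq hΓ hneg hd hF hvol hinfty hper hineq hcomplete i j hs₁ hs₂ hY, mellin]
  refine setIntegral_congr_fun measurableSet_Ioi fun y hy => ?_
  have hy0 : 0 < y := hy
  have hy0' : ((y : ℝ) : ℂ) ≠ 0 := by exact_mod_cast hy0.ne'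
  simp only [cutLow, smul_eq_mul]
  by_cases hyY : y ≤ Y
  · rw [if_pos hyY, if_pos hyY]
    have e2 : (((y ^ 2)⁻¹ : ℝ) : ℂ) = ((y : ℝ) : ℂ) ^ (-2 : ℂ) := by
      rw [Complex.cpow_neg, show (2 : ℂ) = ((2 : ℕ) : ℂ) by norm_num, Complex.cpow_natCast]
      push_cast; ring
    rw [e2, show s₁ - 1 - 1 = s₁ + (-2 : ℂ) by ring, Complex.cpow_add _ _ hy0']
  · rw [if_neg hyY, if_neg hyY]; simp

include hΓ hneg hd hF hvol hinfty hper hineq hcomplete in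
/-- **Holomorphy of the Maass–Selberg pairing in `s₁`** on `Re s₁ > 1` (Mellin transform of a bounded
function supported in `(0, Y]`). [cite: Iwaniec2002, §6.4 (6.30) "extends … by analytic continuation", PDF p. 88] -/
theorem differentiableOn_setIntegral_eisTrunc_mul (i j : Fin h) {s₂ : ℂ} (hs₂ : 1 < s₂.re) {Y : ℝ} (hY : 1 ≤ Y) :
    DifferentiableOn ℂ (fun s₁ => ∫ z in F, eisTrunc Γ σ i s₁ Y z * eisTrunc Γ σ j s₂ Y z) {s : ℂ | 1 < s.re} := by
  have hY0 : 0 < Y := by linarith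
  have hUo : IsOpen {s : ℂ | 1 < s.re} := isOpen_lt continuous_const Complex.continuous_re
  set E₂ : ℍ → ℂ := eisTrunc Γ σ j s₂ Y with hE₂
  obtain ⟨B₂, hB₂⟩ := exists_norm_eisTrunc_le hΓ hneg hd hF hvol hinfty hper hineq hcomplete hs₂ j hY
  have hB0 : 0 ≤ B₂ := (norm_nonneg _).trans (hB₂ UpperHalfPlane.I)
  have hE₂m : Measurable E₂ := measurable_eisTrunc hΓ hd hper hs₂ j hY0
  have hE₂a : IsAutomorphic Γ E₂ := isAutomorphic_eisTrunc hΓ j s₂ Y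
  set C : ℝ → ℂ := fun y => cuspMeanAt (σ i) E₂ (UpperHalfPlane.ofComplex ⟨0, y⟩) with hC
  set fC : ℝ → ℂ := fun y => if y ≤ Y then C y else 0 with hfC
  -- bounds and measurability of `fC`
  have hCb : ∀ y, ‖C y‖ ≤ B₂ := by
    intro y
    simp only [hC, cuspMeanAt_apply]
    have h := intervalIntegral.norm_integral_le_of_norm_le_const (a := (0 : ℝ)) (b := 1) (C := B₂)
      (f := fun x : ℝ => E₂ (σ i • ((x : ℝ) +ᵥ UpperHalfPlane.ofComplex (⟨0, y⟩ : ℂ)))) fun x _ => hB₂ _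
    simpa using h
  have hfCb : ∀ y, ‖fC y‖ ≤ B₂ := by
    intro y; simp only [hfC]; split_ifs; exacts [hCb y, by simpa using hB0]
  have hCm : AEStronglyMeasurable C (volume.restrict (Ioi 0)) :=
    aestronglyMeasurable_cuspMeanAt hΓ hneg hd hF (σ i) (hper i) hE₂a hE₂m hB₂
  have hfCm : AEStronglyMeasurable fC (volume.restrict (Ioi 0)) := by
    have : fC = (Iic Y).piecewise C 0 := by
      funext y; simp only [hfC, Set.piecewise, mem_Iic]; rfl
    rw [this]
    exact AEStronglyMeasurable.piecewise measurableSet_Iic (hCm.mono_measure Measure.restrict_le_self)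
      aestronglyMeasurable_const
  have hfCi : IntegrableOn fC (Ioi 0) := by
    have hE : IntegrableOn fC (Ioc 0 Y) :=
      IntegrableOn.of_bound measure_Ioc_lt_top
        (hfCm.mono_measure (Measure.restrict_mono Ioc_subset_Ioi_self le_rfl)) B₂ (Eventually.of_forall hfCb)
    have hZ : IntegrableOn fC (Ioi Y) := by
      refine integrableOn_zero.congr_fun (fun y hy => ?_) measurableSet_Ioi
      have : ¬ y ≤ Y := not_le.mpr hy
      simp only [hfC, if_neg this]
    have := hE.union hZ
    rwa [Ioc_union_Ioi_eq_Ioi hY0.le] at this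
  have hloc : LocallyIntegrableOn fC (Ioi 0) := hfCi.locallyIntegrableOn
  have htop : ∀ a : ℝ, fC =O[atTop] fun t : ℝ => t ^ (-a) := by
    intro a
    refine IsBigO.of_bound 0 ?_
    filter_upwards [eventually_gt_atTop Y] with t ht
    have : ¬ t ≤ Y := not_le.mpr ht
    simp only [hfC, if_neg this, norm_zero, zero_mul, le_refl]
  have hbot : fC =O[𝓝[>] (0 : ℝ)] fun t : ℝ => t ^ (-(0 : ℝ)) := by
    refine IsBigO.of_bound B₂ ?_
    filter_upwards [self_mem_nhdsWithin] with t _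
    have : ‖(t : ℝ) ^ (-(0 : ℝ))‖ = 1 := by rw [neg_zero, Real.rpow_zero, norm_one]
    rw [this, mul_one]
    exact hfCb t
  intro s₁ hs₁
  have hs₁' : 1 < s₁.re := hs₁
  have hdiff : DifferentiableAt ℂ (fun s => mellin fC (s - 1)) s₁ := by
    have hm : DifferentiableAt ℂ (mellin fC) (s₁ - 1) :=
      mellin_differentiableAt_of_isBigO_rpow (a := s₁.re) (b := 0) hloc (htop _) (by simp) hbot
        (by simp; linarith)
    have h2 : DifferentiableAt ℂ (fun s : ℂ => s - 1) s₁ := differentiableAt_id.sub_const 1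
    have e : (fun s => mellin fC (s - 1)) = mellin fC ∘ fun s : ℂ => s - 1 := rfl
    rw [e]
    exact hm.comp s₁ h2
  have heq : (fun s => ∫ z in F, eisTrunc Γ σ i s Y z * eisTrunc Γ σ j s₂ Y z) =ᶠ[𝓝 s₁]
      fun s => mellin fC (s - 1) := by
    filter_upwards [hUo.mem_nhds hs₁] with s hs
    exact setIntegral_eisTrunc_mul_eq_mellin hΓ hneg hd hF hvol hinfty hper hineq hcomplete i j hs hs₂ hY
  exact (hdiff.congr_of_eventuallyEq heq).differentiableWithinAt

end Mellin

/-! ## 3. Analytic continuation in `s₁`; symmetry of the scattering matrix -/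

section Continuation

open _root_.MeasureTheory _root_.Set _root_.Filter
open scoped _root_.Pointwise _root_.ENNReal _root_.Topology

variable {F : Set ℍ}
variable (hΓ : Γ ≤ (Matrix.SpecialLinearGroup.toGL : SL(2, ℝ) →* GL (Fin 2) ℝ).range)
  (hneg : (-1 : GL (Fin 2) ℝ) ∈ Γ) (hd : IsDiscreteSubgroup Γ) (hF : IsHypFundamentalDomain Γ F)
  (hvol : volume F < ⊤)
  (hinfty : ∀ i, (Matrix.SpecialLinearGroup.toGL (σ i) : GL (Fin 2) ℝ) • (OnePoint.infty : OnePoint ℝ) = 𝔞 i)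
  (hper : ∀ i, (ConjAct.toConjAct (Matrix.SpecialLinearGroup.toGL (σ i) : GL (Fin 2) ℝ)⁻¹ • Γ).strictPeriods =
    AddSubgroup.zmultiples 1)
  (hineq : ∀ i j, ∀ γ ∈ Γ, γ • 𝔞 i = 𝔞 j → i = j)
  (hcomplete : ∀ c : OnePoint ℝ, IsCusp c Γ → ∃ i, ∃ γ ∈ Γ, γ • 𝔞 i = c)

/-- Algebra: `(s₁ - s₂) · RHS(6.30)` cleared of the denominators `s₁ - s₂`, when `s₁ ≠ s₂`. [folklore] -/
private theorem mul_msRHS_eq (i j : Fin h) {s₁ s₂ : ℂ} (hne : s₁ ≠ s₂) (Y : ℝ) :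
    (s₁ - s₂) * ((if i = j then 1 else 0) * (((Y : ℝ) : ℂ) ^ (s₁ + s₂ - 1) / (s₁ + s₂ - 1)) +
        eisScattering Γ σ j i s₂ * (((Y : ℝ) : ℂ) ^ (s₁ - s₂) / (s₁ - s₂)) +
        eisScattering Γ σ i j s₁ * (((Y : ℝ) : ℂ) ^ (s₂ - s₁) / (s₂ - s₁)) -
        (∑ k, eisScattering Γ σ i k s₁ * eisScattering Γ σ j k s₂) *
          (((Y : ℝ) : ℂ) ^ (1 - s₁ - s₂) / (s₁ + s₂ - 1))) =
      ((s₁ - s₂) * ((if i = j then 1 else 0) * (((Y : ℝ) : ℂ) ^ (s₁ + s₂ - 1) / (s₁ + s₂ - 1)) -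
      (∑ k, eisScattering Γ σ i k s₁ * eisScattering Γ σ j k s₂) * (((Y : ℝ) : ℂ) ^ (1 - s₁ - s₂) / (s₁ + s₂ - 1))) +
    eisScattering Γ σ j i s₂ * ((Y : ℝ) : ℂ) ^ (s₁ - s₂) - eisScattering Γ σ i j s₁ * ((Y : ℝ) : ℂ) ^ (s₂ - s₁)) := by
  have h1 : s₁ - s₂ ≠ 0 := sub_ne_zero.mpr hne
  have h2 : s₂ - s₁ ≠ 0 := sub_ne_zero.mpr (Ne.symm hne)
  have e1 : (s₁ - s₂) * (eisScattering Γ σ j i s₂ * (((Y : ℝ) : ℂ) ^ (s₁ - s₂) / (s₁ - s₂))) =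
      eisScattering Γ σ j i s₂ * ((Y : ℝ) : ℂ) ^ (s₁ - s₂) := by
    field_simp
  have e2 : (s₁ - s₂) * (eisScattering Γ σ i j s₁ * (((Y : ℝ) : ℂ) ^ (s₂ - s₁) / (s₂ - s₁))) =
      -(eisScattering Γ σ i j s₁ * ((Y : ℝ) : ℂ) ^ (s₂ - s₁)) := by
    rw [show s₂ - s₁ = -(s₁ - s₂) by ring, div_neg]
    field_simp
  linear_combination e1 + e2

include hΓ hd hper in
/-- The cleared right-hand side is holomorphic in `s₁` on `Re s₁ > 1` (for `Re s₂ > 1`, `Y > 0`). [folklore] -/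
private theorem differentiableOn_msClearedRHS (i j : Fin h) {s₂ : ℂ} (hs₂ : 1 < s₂.re) {Y : ℝ} (hY : 0 < Y) :
    DifferentiableOn ℂ (fun s₁ => ((s₁ - s₂) * ((if i = j then 1 else 0) * (((Y : ℝ) : ℂ) ^ (s₁ + s₂ - 1) / (s₁ + s₂ - 1)) -
      (∑ k, eisScattering Γ σ i k s₁ * eisScattering Γ σ j k s₂) * (((Y : ℝ) : ℂ) ^ (1 - s₁ - s₂) / (s₁ + s₂ - 1))) +
    eisScattering Γ σ j i s₂ * ((Y : ℝ) : ℂ) ^ (s₁ - s₂) - eisScattering Γ σ i j s₁ * ((Y : ℝ) : ℂ) ^ (s₂ - s₁))) {s : ℂ | 1 < s.re} := by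
  have hUo : IsOpen {s : ℂ | 1 < s.re} := isOpen_lt continuous_const Complex.continuous_re
  have hYc : ((Y : ℝ) : ℂ) ≠ 0 := by exact_mod_cast hY.ne'
  have hφ : ∀ k l, DifferentiableOn ℂ (fun s => eisScattering Γ σ k l s) {s : ℂ | 1 < s.re} := fun k l =>
    differentiableOn_eisScattering hΓ hd hper k l
  intro s hs
  have hs' : 1 < s.re := hs
  have hden : s + s₂ - 1 ≠ 0 := by
    intro h0; have := congrArg Complex.re h0; simp at this; linarith
  have hφat : ∀ k l, DifferentiableAt ℂ (fun s => eisScattering Γ σ k l s) s := fun k l =>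
    (hφ k l).differentiableAt (hUo.mem_nhds hs)
  have hp1 : DifferentiableAt ℂ (fun s => ((Y : ℝ) : ℂ) ^ (s + s₂ - 1)) s :=
    ((differentiableAt_id.add (differentiableAt_const _)).sub (differentiableAt_const _)).const_cpow (Or.inl hYc)
  have hp2 : DifferentiableAt ℂ (fun s => ((Y : ℝ) : ℂ) ^ (1 - s - s₂)) s :=
    (((differentiableAt_const _).sub differentiableAt_id).sub (differentiableAt_const _)).const_cpow (Or.inl hYc)
  have hp3 : DifferentiableAt ℂ (fun s => ((Y : ℝ) : ℂ) ^ (s - s₂)) s :=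
    (differentiableAt_id.sub (differentiableAt_const _)).const_cpow (Or.inl hYc)
  have hp4 : DifferentiableAt ℂ (fun s => ((Y : ℝ) : ℂ) ^ (s₂ - s)) s :=
    ((differentiableAt_const _).sub differentiableAt_id).const_cpow (Or.inl hYc)
  have hinv : DifferentiableAt ℂ (fun s => (s + s₂ - 1)⁻¹) s :=
    ((differentiableAt_id.add (differentiableAt_const _)).sub (differentiableAt_const _)).inv hden
  have hS : DifferentiableAt ℂ (fun s => ∑ k, eisScattering Γ σ i k s * eisScattering Γ σ j k s₂) s :=
    DifferentiableAt.fun_sum fun k _ => (hφat i k).mul (differentiableAt_const _)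
  simp only [div_eq_mul_inv]
  exact ((((differentiableAt_id.sub (differentiableAt_const _)).mul
    (((differentiableAt_const _).mul (hp1.mul hinv)).sub (hS.mul (hp2.mul hinv)))).add
    ((differentiableAt_const _).mul hp3)).sub ((hφat i j).mul hp4)).differentiableWithinAt

include hΓ hneg hd hF hvol hinfty hper hineq hcomplete in
/-- **The cleared identity on the whole half-plane**: for `Re s₁ > 1`, `Re s₂ > 1`, `Y ≥ 1`,
`(s₁ - s₂) ∫_F E^Y_𝔞ᵢ(·, s₁) E^Y_𝔞ⱼ(·, s₂) dμ =` the cleared right-hand side — by the identity theorem from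
the half-plane `Re s₁ > Re s₂ + 1` (`maassSelberg`), both sides being holomorphic in `s₁`.
[cite: Iwaniec2002, Prop. 6.8 (6.30), PDF p. 88] -/
private theorem mul_setIntegral_eisTrunc_eq (i j : Fin h) {s₁ s₂ : ℂ} (hs₁ : 1 < s₁.re) (hs₂ : 1 < s₂.re)
    {Y : ℝ} (hY : 1 ≤ Y) :
    (s₁ - s₂) * ∫ z in F, eisTrunc Γ σ i s₁ Y z * eisTrunc Γ σ j s₂ Y z =
      ((s₁ - s₂) * ((if i = j then 1 else 0) * (((Y : ℝ) : ℂ) ^ (s₁ + s₂ - 1) / (s₁ + s₂ - 1)) -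
      (∑ k, eisScattering Γ σ i k s₁ * eisScattering Γ σ j k s₂) * (((Y : ℝ) : ℂ) ^ (1 - s₁ - s₂) / (s₁ + s₂ - 1))) +
    eisScattering Γ σ j i s₂ * ((Y : ℝ) : ℂ) ^ (s₁ - s₂) - eisScattering Γ σ i j s₁ * ((Y : ℝ) : ℂ) ^ (s₂ - s₁)) := by
  have hY0 : 0 < Y := by linarith
  set U : Set ℂ := {s : ℂ | 1 < s.re} with hU
  have hUo : IsOpen U := isOpen_lt continuous_const Complex.continuous_re
  have hUc : IsPreconnected U := (convex_halfSpace_re_gt 1).isPreconnected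
  set f : ℂ → ℂ := fun s => (s - s₂) * ∫ z in F, eisTrunc Γ σ i s Y z * eisTrunc Γ σ j s₂ Y z with hf
  have hfd : DifferentiableOn ℂ f U :=
    (differentiableOn_id.sub (differentiableOn_const _)).mul
      (differentiableOn_setIntegral_eisTrunc_mul hΓ hneg hd hF hvol hinfty hper hineq hcomplete i j hs₂ hY)
  set g : ℂ → ℂ := fun s₁ => ((s₁ - s₂) * ((if i = j then 1 else 0) * (((Y : ℝ) : ℂ) ^ (s₁ + s₂ - 1) / (s₁ + s₂ - 1)) -
        (∑ k, eisScattering Γ σ i k s₁ * eisScattering Γ σ j k s₂) * (((Y : ℝ) : ℂ) ^ (1 - s₁ - s₂) / (s₁ + s₂ - 1))) +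
      eisScattering Γ σ j i s₂ * ((Y : ℝ) : ℂ) ^ (s₁ - s₂) - eisScattering Γ σ i j s₁ * ((Y : ℝ) : ℂ) ^ (s₂ - s₁)) with hg
  have hgd : DifferentiableOn ℂ g U := differentiableOn_msClearedRHS hΓ hd hper i j hs₂ hY0
  -- the base point `s* = s₂ + 2`
  set s₀ : ℂ := s₂ + 2 with hs₀
  have hre₀ : (s₂ + 2).re = s₂.re + 2 := by simp
  have hs₀U : s₀ ∈ U := by show 1 < (s₂ + 2).re; rw [hre₀]; linarith
  have hW : IsOpen {s : ℂ | s₂.re + 1 < s.re} := isOpen_lt continuous_const Complex.continuous_re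
  have hs₀W : s₀ ∈ {s : ℂ | s₂.re + 1 < s.re} := by show s₂.re + 1 < (s₂ + 2).re; rw [hre₀]; linarith
  have hfg : f =ᶠ[𝓝 s₀] g := by
    filter_upwards [hW.mem_nhds hs₀W] with s hs
    have hs' : s₂.re + 1 < s.re := hs
    have hne : s ≠ s₂ := by intro h0; rw [h0] at hs'; linarith
    simp only [hf, hg]
    rw [maassSelberg hΓ hneg hd hF hvol hinfty hper hineq hcomplete i j hs₂ hs' hY]
    exact mul_msRHS_eq i j hne Y
  have hEq := (hfd.analyticOnNhd hUo).eqOn_of_preconnected_of_eventuallyEq (hgd.analyticOnNhd hUo) hUc hs₀U hfg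
  exact hEq hs₁

include hΓ hneg hd hF hvol hinfty hper hineq hcomplete in
/-- **Iwaniec, Proposition 6.8 — the Maass–Selberg relations for a general finite volume group on the
whole region of absolute convergence**: for `Re s₁ > 1`, `Re s₂ > 1`, `s₁ ≠ s₂`, `Y ≥ 1`,
`∫_F E^Y_𝔞ᵢ(·, s₁) E^Y_𝔞ⱼ(·, s₂) dμ = δᵢⱼ Y^{s₁+s₂-1}/(s₁+s₂-1) + φⱼᵢ(s₂) Y^{s₁-s₂}/(s₁-s₂) + φᵢⱼ(s₁) Y^{s₂-s₁}/(s₂-s₁) - (Σₖ φᵢₖ(s₁)φⱼₖ(s₂)) Y^{1-s₁-s₂}/(s₁+s₂-1)`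
(analytic continuation in `s₁` of `maassSelberg` from `Re s₁ > Re s₂ + 1`).
[cite: Iwaniec2002, Prop. 6.8 (6.30), PDF p. 88] -/
theorem maassSelberg_of_ne (i j : Fin h) {s₁ s₂ : ℂ} (hs₁ : 1 < s₁.re) (hs₂ : 1 < s₂.re) (hne : s₁ ≠ s₂)
    {Y : ℝ} (hY : 1 ≤ Y) :
    ∫ z in F, eisTrunc Γ σ i s₁ Y z * eisTrunc Γ σ j s₂ Y z =
      (if i = j then 1 else 0) * (((Y : ℝ) : ℂ) ^ (s₁ + s₂ - 1) / (s₁ + s₂ - 1)) +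
        eisScattering Γ σ j i s₂ * (((Y : ℝ) : ℂ) ^ (s₁ - s₂) / (s₁ - s₂)) +
        eisScattering Γ σ i j s₁ * (((Y : ℝ) : ℂ) ^ (s₂ - s₁) / (s₂ - s₁)) -
        (∑ k, eisScattering Γ σ i k s₁ * eisScattering Γ σ j k s₂) *
          (((Y : ℝ) : ℂ) ^ (1 - s₁ - s₂) / (s₁ + s₂ - 1)) := by
  have h1 : s₁ - s₂ ≠ 0 := sub_ne_zero.mpr hne
  have hm := mul_setIntegral_eisTrunc_eq hΓ hneg hd hF hvol hinfty hper hineq hcomplete i j hs₁ hs₂ hY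
  rw [← mul_msRHS_eq i j hne Y] at hm
  exact mul_left_cancel₀ h1 hm

include hΓ hneg hd hF hvol hinfty hper hineq hcomplete in
/-- **Iwaniec (6.25): the scattering matrix is symmetric, `φ_𝔞𝔟(s) = φ_𝔟𝔞(s)`, for `Re s > 1`**
(finite volume group, complete system of inequivalent cusps). The book reads this off the Dirichlet
series representation (3.21); here it drops out of the Maass–Selberg relations: the pairing
`∫_F E^Y_𝔞(·, s₁) E^Y_𝔟(·, s₂) dμ` is holomorphic at `s₁ = s₂ = s`, so the residue
`φ_𝔟𝔞(s) - φ_𝔞𝔟(s)` of the right-hand side of (6.30) must vanish.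
[cite: Iwaniec2002, Thm 6.6 proof, (6.25), PDF p. 87] -/
theorem eisScattering_symm (i j : Fin h) {s : ℂ} (hs : 1 < s.re) :
    eisScattering Γ σ i j s = eisScattering Γ σ j i s := by
  have hm := mul_setIntegral_eisTrunc_eq hΓ hneg hd hF hvol hinfty hper hineq hcomplete i j hs hs (le_refl (1 : ℝ))
  have key : ((s - s) * ((if i = j then 1 else 0) * (((1 : ℝ) : ℂ) ^ (s + s - 1) / (s + s - 1)) -
      (∑ k, eisScattering Γ σ i k s * eisScattering Γ σ j k s) * (((1 : ℝ) : ℂ) ^ (1 - s - s) / (s + s - 1))) +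
    eisScattering Γ σ j i s * ((1 : ℝ) : ℂ) ^ (s - s) - eisScattering Γ σ i j s * ((1 : ℝ) : ℂ) ^ (s - s)) =
      eisScattering Γ σ j i s - eisScattering Γ σ i j s := by
    simp
  rw [key, sub_self s, zero_mul] at hm
  exact (sub_eq_zero.mp hm.symm).symm

end Continuation

end Fuchsian

end Literature.NumberTheory.Automorphic

end
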